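import Summits.CriticalPhenomena.PercolationContinuityZ3.Theorems.PercNearOneGluingNoHeavyQuantFarTwoAnchorBlock
import Summits.CriticalPhenomena.PercolationContinuityZ3.Theorems.PercNearOneGluingNoHeavyQuantFarTwoAnchorAlgebra
import Summits.CriticalPhenomena.PercolationContinuityZ3.Theorems.PercNearOneGluingNoHeavyQuantFarBlockTransfer
import HarnessLib

/-!
# QUANT lane R8, front "FAR beyond trees", layer one — TWO-ANCHOR BLOCKS IV: the TWO-ANCHOR TRANSFER theorem and its FAR form

builds on p205010 (kernel theorem, internal audit signed; external expert review pending)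

Support file (`--supports stmt-CriticalPhenomena-4575`), seat `prim-quant-p1` (gen 19); memo
`run/shared/lean/prim/quant/prim-quant-p1-g19/FOR-LEAD-CACTI.md` §3 (kernel plan §5, file K5d).  Standard axioms; no sorries; no definitions.

* **`Block.real_card_le_one_le_twoAnchor`** — for a two-anchor pendant block (`Block.IsTwoAnchor c v₁ v₂ Z L par`: block `Z` hanging at the cut
  vertex `c`, arbitrary core, leaves pendant at the anchors `v₁, v₂`, block relays = leaves, at least one) of a finite weighted graph
  `w` and its DECOUPLED weights `w' = Block.decouple … w` (same graph off the block; inside, two independent bundles at `c` with stems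
  `mᵢ = P_w(c ↔ vᵢ in core)` and the same hairs — a pendant tree with the same relay marginals):
  `P_{w'}(#{a ∈ A : o ↔ a} ≤ 1) ≤ t` and `P_w(o ↮ a) ≤ t` on the block relays imply `P_w(#{a ∈ A : o ↔ a} ≤ 1) ≤ t`.
PROOF.  By `…TwoAnchorLaw` the internal numbers of `w` and `w'` are the two-anchor formulas with `p₁₁ = P_w(E₁E₂) ∈ [m₁m₂, min mᵢ]` (Harris)
resp. `p₁₁ = m₁m₂` (`…TwoAnchorBlock`); `Block.twoAnchor_dominates` (Case A: the `m₁m₂`-cancellation; Case B: exit) produces `λ ∈ [0,1]` with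
`λ(h',t') + (1−λ)(q,q) ≤ (h_S,t_S)`, `q` = the least internal tip marginal; `Block.real_card_le_one_le_of_dominates` transfers.
* `Block.real_openConn_decouple_eq` — every relay keeps its marginal under decoupling: `P_{w'}(o ↔ a) = P_w(o ↔ a)` for `a ∈ A`;
* **`Block.farLayerOne_twoAnchor`** — hence the `j = 1` instance of `Quant.FarRelayRow` at `(A, o, t)` for the decoupled weights implies the same
  instance for `w` (`2 < Σ_a P_w(o ↔ a)` and `P_w(o ↮ a) ≤ t` on `A` give `P_w(N ≤ 1) ≤ t`).
USE.  In a layer-one FAR argument a pendant block loaded at ≤ 2 vertices may be replaced by two bundles at its cut vertex (a pendant tree, one block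
fewer; then flattened by p1 g18's `Bundle.*`); e.g. every triangle of a triangle cactus (memo §3; assembly pending).
[cite: Grimmett1999, §1.3 p. 10; Thm. (2.4) p. 34] (product measure, Harris' inequality); the theorem [this work].
-/

noncomputable section

namespace Summit.CriticalPhenomena.PercolationContinuityZ3.Theorems

namespace Quant

namespace Block

open Finset MeasureTheory Set
open Literature.Probability.LatticeModels
open Literature.Probability.Percolation
open Bundle (offZ avoid real_offZ_event_eq_of_agree)
open scoped Classical

variable {n : ℕ} {o c v₁ v₂ : Fin n} {Z L : Finset (Fin n)} {par : Fin n → Fin n}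

/-- Law of a hair count: `P(Y ≥ 1) = P(Y = 1) + P(Y ≥ 2)` and `P(Y = 0) = 1 − P(Y ≥ 1)`. [folklore] -/
theorem real_hair_laws (μ : Measure (BondConfig (Fin n))) [IsProbabilityMeasure μ] (v : Fin n) (B : Finset (Fin n)) :
    μ.real {ω | 1 ≤ (B.filter fun ℓ => s(v, ℓ) ∈ ω).card} =
        μ.real {ω | (B.filter fun ℓ => s(v, ℓ) ∈ ω).card = 1} + μ.real {ω | 2 ≤ (B.filter fun ℓ => s(v, ℓ) ∈ ω).card} ∧
      μ.real {ω | (B.filter fun ℓ => s(v, ℓ) ∈ ω).card = 0} = 1 - μ.real {ω | 1 ≤ (B.filter fun ℓ => s(v, ℓ) ∈ ω).card} := by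
  have hmeas : ∀ U : Set (BondConfig (Fin n)), MeasurableSet U := fun U => (Set.toFinite U).measurableSet
  constructor
  · have h := measureReal_inter_add_sdiff (μ := μ) (s := {ω : BondConfig (Fin n) | 1 ≤ (B.filter fun ℓ => s(v, ℓ) ∈ ω).card})
      (hmeas {ω | 2 ≤ (B.filter fun ℓ => s(v, ℓ) ∈ ω).card})
    have e1 : {ω : BondConfig (Fin n) | 1 ≤ (B.filter fun ℓ => s(v, ℓ) ∈ ω).card} ∩ {ω | 2 ≤ (B.filter fun ℓ => s(v, ℓ) ∈ ω).card} =
        {ω | 2 ≤ (B.filter fun ℓ => s(v, ℓ) ∈ ω).card} := by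
      ext ω; simp only [Set.mem_inter_iff, mem_setOf_eq]; omega
    have e2 : {ω : BondConfig (Fin n) | 1 ≤ (B.filter fun ℓ => s(v, ℓ) ∈ ω).card} \ {ω | 2 ≤ (B.filter fun ℓ => s(v, ℓ) ∈ ω).card} =
        {ω | (B.filter fun ℓ => s(v, ℓ) ∈ ω).card = 1} := by
      ext ω; simp only [Set.mem_sdiff, mem_setOf_eq]; omega
    rw [e1, e2] at h; linarith
  · have e3 : {ω : BondConfig (Fin n) | (B.filter fun ℓ => s(v, ℓ) ∈ ω).card = 0} =
        {ω : BondConfig (Fin n) | 1 ≤ (B.filter fun ℓ => s(v, ℓ) ∈ ω).card}ᶜ := by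
      ext ω; simp only [Set.mem_compl_iff, mem_setOf_eq]; omega
    rw [e3, probReal_compl_eq_one_sub (hmeas _)]

/-- **TWO-ANCHOR TRANSFER.**  For a two-anchor pendant block carrying at least one relay and its decoupled weights `w'`:
`P_{w'}(N ≤ 1) ≤ t` and `P_w(o ↮ a) ≤ t` for the block relays imply `P_w(N ≤ 1) ≤ t` (both anchors loaded: `Block.twoAnchor_dominates`;
one anchor loaded: the internal numbers coincide). [this work] -/
theorem real_card_le_one_le_twoAnchor (H : IsTwoAnchor c v₁ v₂ Z L par) (w : Sym2 (Fin n) → unitInterval) (ho : o ∉ Z)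
    (hwZ : ∀ x y : Fin n, x ≠ y → x ∈ Z → y ∉ Z → y ≠ c → (w s(x, y) : ℝ) = 0)
    (hwL : ∀ ℓ ∈ L, ∀ x : Fin n, x ≠ ℓ → x ≠ par ℓ → (w s(ℓ, x) : ℝ) = 0)
    (A : Finset (Fin n)) (hA : A ∩ Z ⊆ L) (hAZ : (A ∩ Z).Nonempty)
    (t : ℝ) (hcut : ∀ a ∈ A ∩ Z, (prodBernoulli w).real (openConn o a)ᶜ ≤ t)
    (hfar' : (prodBernoulli (decouple c v₁ v₂ Z L par w)).real
      {ω : BondConfig (Fin n) | (A.filter fun a => ω ∈ openConn o a).card ≤ 1} ≤ t) :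
    (prodBernoulli w).real {ω : BondConfig (Fin n) | (A.filter fun a => ω ∈ openConn o a).card ≤ 1} ≤ t := by
  set w' := decouple c v₁ v₂ Z L par w with hw'
  set μ := prodBernoulli w with hμ
  set μ' := prodBernoulli w' with hμ'
  have hmeas : ∀ U : Set (BondConfig (Fin n)), MeasurableSet U := fun U => (Set.toFinite U).measurableSet
  have hw'L : ∀ ℓ ∈ L, ∀ x : Fin n, x ≠ ℓ → x ≠ par ℓ → (w' s(ℓ, x) : ℝ) = 0 := decouple_leaf_vanish H w
  -- core events and their probabilities
  set E₁ := {ω : BondConfig (Fin n) | core Z L ω ∈ openConn c v₁} with hE₁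
  set E₂ := {ω : BondConfig (Fin n) | core Z L ω ∈ openConn c v₂} with hE₂
  set m₁ := μ.real E₁ with hm₁
  set m₂ := μ.real E₂ with hm₂
  set p := μ.real (E₁ ∩ E₂) with hp
  have hm₁0 : 0 ≤ m₁ := measureReal_nonneg
  have hm₂0 : 0 ≤ m₂ := measureReal_nonneg
  have hp₁ : p ≤ m₁ := measureReal_mono Set.inter_subset_left
  have hp₂ : p ≤ m₂ := measureReal_mono Set.inter_subset_right
  have hpm : m₁ * m₂ ≤ p := prodBernoulli_harris w (isUpperSet_coreReach c v₁ Z L) (isUpperSet_coreReach c v₂ Z L) (hmeas _) (hmeas _)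
  have h10 : μ.real (E₁ \ E₂) = m₁ - p := by
    have := measureReal_inter_add_sdiff (μ := μ) (s := E₁) (hmeas E₂); linarith
  have h01 : μ.real (E₂ \ E₁) = m₂ - p := by
    have := measureReal_inter_add_sdiff (μ := μ) (s := E₂) (hmeas E₁); rw [Set.inter_comm] at this; linarith
  have hm₁' : μ'.real E₁ = m₁ := real_coreReach_decouple₁ H w
  have hm₂' : μ'.real E₂ = m₂ := real_coreReach_decouple₂ H w
  have hp' : μ'.real (E₁ ∩ E₂) = m₁ * m₂ := real_coreReach_inter_decouple H w
  have h10' : μ'.real (E₁ \ E₂) = m₁ - m₁ * m₂ := by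
    have := measureReal_inter_add_sdiff (μ := μ') (s := E₁) (hmeas E₂); linarith
  have h01' : μ'.real (E₂ \ E₁) = m₂ - m₁ * m₂ := by
    have := measureReal_inter_add_sdiff (μ := μ') (s := E₂) (hmeas E₁); rw [Set.inter_comm] at this; linarith
  -- hair laws
  set A₁ := (A ∩ Z).filter fun a => par a = v₁ with hA₁def
  set A₂ := (A ∩ Z).filter fun a => par a = v₂ with hA₂def
  have hA₁L : A₁ ⊆ L := fun a ha => hA (mem_filter.1 ha).1
  have hA₂L : A₂ ⊆ L := fun a ha => hA (mem_filter.1 ha).1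
  have hpar₁ : ∀ ℓ ∈ A₁, par ℓ = v₁ := fun ℓ hℓ => (mem_filter.1 hℓ).2
  have hpar₂ : ∀ ℓ ∈ A₂, par ℓ = v₂ := fun ℓ hℓ => (mem_filter.1 hℓ).2
  set s₁ := μ.real {ω | (A₁.filter fun ℓ => s(v₁, ℓ) ∈ ω).card = 1} with hs₁
  set d₁ := μ.real {ω | 2 ≤ (A₁.filter fun ℓ => s(v₁, ℓ) ∈ ω).card} with hd₁
  set u₁ := μ.real {ω | 1 ≤ (A₁.filter fun ℓ => s(v₁, ℓ) ∈ ω).card} with hu₁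
  set z₁ := μ.real {ω | (A₁.filter fun ℓ => s(v₁, ℓ) ∈ ω).card = 0} with hz₁
  set s₂ := μ.real {ω | (A₂.filter fun ℓ => s(v₂, ℓ) ∈ ω).card = 1} with hs₂
  set d₂ := μ.real {ω | 2 ≤ (A₂.filter fun ℓ => s(v₂, ℓ) ∈ ω).card} with hd₂
  set u₂ := μ.real {ω | 1 ≤ (A₂.filter fun ℓ => s(v₂, ℓ) ∈ ω).card} with hu₂
  obtain ⟨hu₁eq, hz₁eq⟩ := real_hair_laws μ v₁ A₁
  obtain ⟨hu₂eq, -⟩ := real_hair_laws μ v₂ A₂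
  have hu : u₁ = s₁ + d₁ := hu₁eq
  have hz : z₁ = 1 - u₁ := hz₁eq
  have hu' : u₂ = s₂ + d₂ := hu₂eq
  have hs₁0 : 0 ≤ s₁ := measureReal_nonneg
  have hd₁0 : 0 ≤ d₁ := measureReal_nonneg
  have hs₂0 : 0 ≤ s₂ := measureReal_nonneg
  have hd₂0 : 0 ≤ d₂ := measureReal_nonneg
  have hu₁1 : u₁ ≤ 1 := measureReal_le_one
  have hu₂1 : u₂ ≤ 1 := measureReal_le_one
  -- the same hair laws under `w'`
  have hs₁' : μ'.real {ω | (A₁.filter fun ℓ => s(v₁, ℓ) ∈ ω).card = 1} = s₁ := real_hair_decouple H w v₁ hA₁L hpar₁ fun k => k = 1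
  have hd₁' : μ'.real {ω | 2 ≤ (A₁.filter fun ℓ => s(v₁, ℓ) ∈ ω).card} = d₁ := real_hair_decouple H w v₁ hA₁L hpar₁ fun k => 2 ≤ k
  have hu₁' : μ'.real {ω | 1 ≤ (A₁.filter fun ℓ => s(v₁, ℓ) ∈ ω).card} = u₁ := real_hair_decouple H w v₁ hA₁L hpar₁ fun k => 1 ≤ k
  have hz₁' : μ'.real {ω | (A₁.filter fun ℓ => s(v₁, ℓ) ∈ ω).card = 0} = z₁ := real_hair_decouple H w v₁ hA₁L hpar₁ fun k => k = 0
  have hd₂' : μ'.real {ω | 2 ≤ (A₂.filter fun ℓ => s(v₂, ℓ) ∈ ω).card} = d₂ := real_hair_decouple H w v₂ hA₂L hpar₂ fun k => 2 ≤ k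
  have hu₂' : μ'.real {ω | 1 ≤ (A₂.filter fun ℓ => s(v₂, ℓ) ∈ ω).card} = u₂ := real_hair_decouple H w v₂ hA₂L hpar₂ fun k => 1 ≤ k
  -- internal numbers
  set hS := μ.real {ω | 1 ≤ ((A ∩ Z).filter fun a => onZ Z ω ∈ openConn c a).card} with hhS
  set tS := μ.real {ω | 2 ≤ ((A ∩ Z).filter fun a => onZ Z ω ∈ openConn c a).card} with htS
  set hP := μ'.real {ω | 1 ≤ ((A ∩ Z).filter fun a => onZ Z ω ∈ openConn c a).card} with hhP
  set tP := μ'.real {ω | 2 ≤ ((A ∩ Z).filter fun a => onZ Z ω ∈ openConn c a).card} with htP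
  have fS : hS = m₁ * (s₁ + d₁) + m₂ * (s₂ + d₂) - p * (s₁ + d₁) * (s₂ + d₂) := by
    have h := real_one_le_X_eq H w hwL hA
    rw [← hμ] at h
    change hS = μ.real (E₁ \ E₂) * u₁ + μ.real (E₂ \ E₁) * u₂ + μ.real (E₁ ∩ E₂) * u₁ + μ.real (E₁ ∩ E₂) * z₁ * u₂ at h
    rw [h, h10, h01, ← hp, hz, hu, hu']; ring
  have fT : tS = m₁ * d₁ + m₂ * d₂ + p * (s₁ * (s₂ + d₂) - (s₁ + d₁) * d₂) := by
    have h := real_two_le_X_eq H w hwL hA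
    rw [← hμ] at h
    change tS = μ.real (E₁ \ E₂) * d₁ + μ.real (E₂ \ E₁) * d₂ + μ.real (E₁ ∩ E₂) * d₁ + μ.real (E₁ ∩ E₂) * s₁ * u₂ +
      μ.real (E₁ ∩ E₂) * z₁ * d₂ at h
    rw [h, h10, h01, ← hp, hz, hu, hu']; ring
  have fP : hP = m₁ * (s₁ + d₁) + m₂ * (s₂ + d₂) - m₁ * m₂ * (s₁ + d₁) * (s₂ + d₂) := by
    have h := real_one_le_X_eq H w' hw'L hA
    rw [← hμ'] at h
    change hP = μ'.real (E₁ \ E₂) * μ'.real {ω | 1 ≤ (A₁.filter fun ℓ => s(v₁, ℓ) ∈ ω).card} +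
      μ'.real (E₂ \ E₁) * μ'.real {ω | 1 ≤ (A₂.filter fun ℓ => s(v₂, ℓ) ∈ ω).card} +
      μ'.real (E₁ ∩ E₂) * μ'.real {ω | 1 ≤ (A₁.filter fun ℓ => s(v₁, ℓ) ∈ ω).card} +
      μ'.real (E₁ ∩ E₂) * μ'.real {ω | (A₁.filter fun ℓ => s(v₁, ℓ) ∈ ω).card = 0} *
        μ'.real {ω | 1 ≤ (A₂.filter fun ℓ => s(v₂, ℓ) ∈ ω).card} at h
    rw [h, h10', h01', hp', hu₁', hu₂', hz₁', hz, hu, hu']; ring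
  have fQ : tP = m₁ * d₁ + m₂ * d₂ + m₁ * m₂ * (s₁ * (s₂ + d₂) - (s₁ + d₁) * d₂) := by
    have h := real_two_le_X_eq H w' hw'L hA
    rw [← hμ'] at h
    change tP = μ'.real (E₁ \ E₂) * μ'.real {ω | 2 ≤ (A₁.filter fun ℓ => s(v₁, ℓ) ∈ ω).card} +
      μ'.real (E₂ \ E₁) * μ'.real {ω | 2 ≤ (A₂.filter fun ℓ => s(v₂, ℓ) ∈ ω).card} +
      μ'.real (E₁ ∩ E₂) * μ'.real {ω | 2 ≤ (A₁.filter fun ℓ => s(v₁, ℓ) ∈ ω).card} +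
      μ'.real (E₁ ∩ E₂) * μ'.real {ω | (A₁.filter fun ℓ => s(v₁, ℓ) ∈ ω).card = 1} *
        μ'.real {ω | 1 ≤ (A₂.filter fun ℓ => s(v₂, ℓ) ∈ ω).card} +
      μ'.real (E₁ ∩ E₂) * μ'.real {ω | (A₁.filter fun ℓ => s(v₁, ℓ) ∈ ω).card = 0} *
        μ'.real {ω | 2 ≤ (A₂.filter fun ℓ => s(v₂, ℓ) ∈ ω).card} at h
    rw [h, h10', h01', hp', hd₁', hd₂', hs₁', hu₂', hz₁', hz, hu, hu']; ring
  -- the least internal tip marginal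
  set τ : Fin n → ℝ := fun a => μ.real {ω | onZ Z ω ∈ openConn c a} with hτ
  obtain ⟨a₀, ha₀, hmin⟩ := (A ∩ Z).exists_min_image τ hAZ
  set q := τ a₀ with hq
  have hq1 : q ≤ 1 := measureReal_le_one
  -- `q ≤ mᵢ uᵢ` through a loaded leaf `ℓ` with parent `vᵢ`
  have hleaf : ∀ {ℓ v : Fin n} {B : Finset (Fin n)}, ℓ ∈ B → ℓ ∈ L → par ℓ = v →
      τ ℓ ≤ μ.real {ω | core Z L ω ∈ openConn c v} * μ.real {ω | 1 ≤ (B.filter fun ℓ' => s(v, ℓ') ∈ ω).card} := by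
    intro ℓ v B hℓB hℓL hpv
    have h1 : τ ℓ = μ.real {ω | core Z L ω ∈ openConn c (par ℓ)} * (w s(par ℓ, ℓ) : ℝ) := real_onReach_leaf H w hwL hℓL
    rw [hpv] at h1
    rw [h1]
    refine mul_le_mul_of_nonneg_left ?_ measureReal_nonneg
    rw [← prodBernoulli_real_setOf_mem w s(v, ℓ)]
    refine measureReal_mono (fun ω hω => ?_)
    simp only [mem_setOf_eq] at hω ⊢
    exact Finset.card_pos.2 ⟨ℓ, mem_filter.2 ⟨hℓB, hω⟩⟩
  have hsd₁ : s₁ + d₁ ≤ 1 := by rw [← hu]; exact hu₁1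
  have hsd₂ : s₂ + d₂ ≤ 1 := by rw [← hu']; exact hu₂1
  -- an unloaded anchor has a trivial bundle
  have hempty : ∀ {v : Fin n} {B : Finset (Fin n)} (P : ℕ → Prop), B = ∅ → ¬ P 0 →
      μ.real {ω : BondConfig (Fin n) | P ((B.filter fun ℓ => s(v, ℓ) ∈ ω).card)} = 0 := by
    intro v B P hB hP
    have : {ω : BondConfig (Fin n) | P ((B.filter fun ℓ => s(v, ℓ) ∈ ω).card)} = ∅ := by
      ext ω
      simp only [hB, Finset.filter_empty, Finset.card_empty, mem_setOf_eq, Set.mem_empty_iff_false, iff_false]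
      exact hP
    rw [this, measureReal_empty]
  -- domination: both anchors loaded (real algebra) or one anchor loaded (the internal numbers coincide)
  have hdom : ∃ lam : ℝ, 0 ≤ lam ∧ lam ≤ 1 ∧ lam * hP + (1 - lam) * q ≤ hS ∧ lam * tP + (1 - lam) * q ≤ tS := by
    by_cases hne₁ : A₁.Nonempty
    · by_cases hne₂ : A₂.Nonempty
      · obtain ⟨ℓ₁, hℓ₁⟩ := hne₁
        obtain ⟨ℓ₂, hℓ₂⟩ := hne₂
        have hq₁ : q ≤ m₁ * (s₁ + d₁) := by
          rw [← hu]; exact (hmin ℓ₁ (mem_filter.1 hℓ₁).1).trans (hleaf hℓ₁ (hA₁L hℓ₁) (hpar₁ ℓ₁ hℓ₁))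
        have hq₂ : q ≤ m₂ * (s₂ + d₂) := by
          rw [← hu']; exact (hmin ℓ₂ (mem_filter.1 hℓ₂).1).trans (hleaf hℓ₂ (hA₂L hℓ₂) (hpar₂ ℓ₂ hℓ₂))
        exact twoAnchor_dominates m₁ m₂ p s₁ d₁ s₂ d₂ q hS tS hP tP hm₁0 hm₂0 hp₁ hp₂ hpm
          hs₁0 hd₁0 hs₂0 hd₂0 hsd₁ hsd₂ hq₁ hq₂ fS fT fP fQ
      · have hA₂e : A₂ = ∅ := Finset.not_nonempty_iff_eq_empty.1 hne₂
        have hs₂z : s₂ = 0 := hempty (fun k => k = 1) hA₂e (by norm_num)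
        have hd₂z : d₂ = 0 := hempty (fun k => 2 ≤ k) hA₂e (by norm_num)
        have e1 : hS = hP := by rw [fS, fP, hs₂z, hd₂z]; ring
        have e2 : tS = tP := by rw [fT, fQ, hs₂z, hd₂z]; ring
        exact ⟨1, zero_le_one, le_refl _, by rw [e1]; linarith, by rw [e2]; linarith⟩
    · have hA₁e : A₁ = ∅ := Finset.not_nonempty_iff_eq_empty.1 hne₁
      have hs₁z : s₁ = 0 := hempty (fun k => k = 1) hA₁e (by norm_num)
      have hd₁z : d₁ = 0 := hempty (fun k => 2 ≤ k) hA₁e (by norm_num)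
      have e1 : hS = hP := by rw [fS, fP, hs₁z, hd₁z]; ring
      have e2 : tS = tP := by rw [fT, fQ, hs₁z, hd₁z]; ring
      exact ⟨1, zero_le_one, le_refl _, by rw [e1]; linarith, by rw [e2]; linarith⟩
  obtain ⟨lam, hlam0, hlam1, hdomh, hdomt⟩ := hdom
  exact real_card_le_one_le_of_dominates w w' ho H.cZ hwZ (decouple_block_vanish H w) (fun e he => (decouple_of_avoid w he).symm)
    A t q lam hlam0 hlam1 hq1 ha₀ (le_refl _) (hcut a₀ ha₀) hdomh hdomt hfar'

/-! ## Marginals are preserved; the layer-one FAR instance transfers -/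

/-- **Decoupling preserves the relay marginals.**  For `a ∈ A` (block relays being leaves): `P_{w'}(o ↔ a) = P_w(o ↔ a)`. [this work] -/
theorem real_openConn_decouple_eq (H : IsTwoAnchor c v₁ v₂ Z L par) (w : Sym2 (Fin n) → unitInterval) (ho : o ∉ Z)
    (hwZ : ∀ x y : Fin n, x ≠ y → x ∈ Z → y ∉ Z → y ≠ c → (w s(x, y) : ℝ) = 0)
    (hwL : ∀ ℓ ∈ L, ∀ x : Fin n, x ≠ ℓ → x ≠ par ℓ → (w s(ℓ, x) : ℝ) = 0)
    {A : Finset (Fin n)} (hA : A ∩ Z ⊆ L) {a : Fin n} (ha : a ∈ A) :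
    (prodBernoulli (decouple c v₁ v₂ Z L par w)).real (openConn o a) = (prodBernoulli w).real (openConn o a) := by
  have hw'Z := decouple_block_vanish H w
  have hw'L := decouple_leaf_vanish H w
  have hagree : ∀ e ∈ avoid Z, w e = decouple c v₁ v₂ Z L par w e := fun e he => (decouple_of_avoid w he).symm
  by_cases haZ : a ∈ Z
  · -- a leaf: `P(o ↔ c off Z) · P(c ↔ par a in core) · weight of its hair`
    have haL : a ∈ L := hA (Finset.mem_inter.2 ⟨ha, haZ⟩)
    rw [real_openConn_in_eq (decouple c v₁ v₂ Z L par w) ho H.cZ hw'Z haZ, real_openConn_in_eq w ho H.cZ hwZ haZ,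
      real_onReach_leaf H (decouple c v₁ v₂ Z L par w) hw'L haL, real_onReach_leaf H w hwL haL,
      ← real_offZ_event_eq_of_agree w (decouple c v₁ v₂ Z L par w) Z hagree (fun η => η ∈ openConn o c), decouple_hair H w haL]
    rcases H.parv a haL with hp | hp <;> rw [hp]
    · rw [real_coreReach_decouple₁ H w]
    · rw [real_coreReach_decouple₂ H w]
  · rw [real_openConn_off_eq (c := c) (decouple c v₁ v₂ Z L par w) ho hw'Z haZ, real_openConn_off_eq (c := c) w ho hwZ haZ,
      ← real_offZ_event_eq_of_agree w (decouple c v₁ v₂ Z L par w) Z hagree (fun η => η ∈ openConn o a)]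

/-- **The layer-one FAR instance transfers from the decoupled graph.**  If for the decoupled weights `w'`
`2 < Σ_{a∈A} P_{w'}(o ↔ a)` and `P_{w'}(o ↮ a) ≤ t` on `A` imply `P_{w'}(#{a ∈ A : o ↔ a} ≤ 1) ≤ t`, then the same holds for `w`
(two-anchor pendant block, block relays = leaves, at least one). [this work] -/
theorem farLayerOne_twoAnchor (H : IsTwoAnchor c v₁ v₂ Z L par) (w : Sym2 (Fin n) → unitInterval) (ho : o ∉ Z)
    (hwZ : ∀ x y : Fin n, x ≠ y → x ∈ Z → y ∉ Z → y ≠ c → (w s(x, y) : ℝ) = 0)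
    (hwL : ∀ ℓ ∈ L, ∀ x : Fin n, x ≠ ℓ → x ≠ par ℓ → (w s(ℓ, x) : ℝ) = 0)
    (A : Finset (Fin n)) (hA : A ∩ Z ⊆ L) (hAZ : (A ∩ Z).Nonempty) (t : ℝ)
    (hfar' : (2 : ℝ) < ∑ a ∈ A, (prodBernoulli (decouple c v₁ v₂ Z L par w)).real (openConn o a) →
      (∀ a ∈ A, (prodBernoulli (decouple c v₁ v₂ Z L par w)).real (openConn o a)ᶜ ≤ t) →
      (prodBernoulli (decouple c v₁ v₂ Z L par w)).real {ω : BondConfig (Fin n) | (A.filter fun a => ω ∈ openConn o a).card ≤ 1} ≤ t)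
    (hsum : (2 : ℝ) < ∑ a ∈ A, (prodBernoulli w).real (openConn o a))
    (hcut : ∀ a ∈ A, (prodBernoulli w).real (openConn o a)ᶜ ≤ t) :
    (prodBernoulli w).real {ω : BondConfig (Fin n) | (A.filter fun a => ω ∈ openConn o a).card ≤ 1} ≤ t := by
  have hmeas : ∀ U : Set (BondConfig (Fin n)), MeasurableSet U := fun U => (Set.toFinite U).measurableSet
  have hmarg : ∀ a ∈ A, (prodBernoulli (decouple c v₁ v₂ Z L par w)).real (openConn o a) = (prodBernoulli w).real (openConn o a) :=
    fun a ha => real_openConn_decouple_eq H w ho hwZ hwL hA ha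
  have hsum' : (2 : ℝ) < ∑ a ∈ A, (prodBernoulli (decouple c v₁ v₂ Z L par w)).real (openConn o a) := by
    rw [Finset.sum_congr rfl hmarg]; exact hsum
  have hcut' : ∀ a ∈ A, (prodBernoulli (decouple c v₁ v₂ Z L par w)).real (openConn o a)ᶜ ≤ t := by
    intro a ha
    rw [probReal_compl_eq_one_sub (hmeas _), hmarg a ha, ← probReal_compl_eq_one_sub (hmeas _)]
    exact hcut a ha
  exact real_card_le_one_le_twoAnchor H w ho hwZ hwL A hA hAZ t (fun a ha => hcut a (Finset.mem_inter.1 ha).1)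
    (hfar' hsum' hcut')

end Block

end Quant

end Summit.CriticalPhenomena.PercolationContinuityZ3.Theorems
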